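import Literature.IUT.LogVolume.LocalFieldVolume
import Literature.IUT.LogVolume.FinitelyAdditiveVolume
import Mathlib.MeasureTheory.Measure.Haar.Basic
import HarnessLib

/-!
# Volumes over a PRIME residue field: compact open subgroups and subsets of a local field

Classical bookkeeping for [IUTchIII] Rmk. 3.9.5 (iv) (Ξ1^non) (kurims p. 128: "the residue field
extension degree of each valuation … that divides `v_ℚ` is `= 1`"), over the volume `μ_k` /
log-volume `μ^log_k` of [AbsTopIII] Prop. 5.7 (i) as constructed in `LocalFieldVolume.lean`
(abc-iut-S1/S2) for a nonarchimedean local field `K` in the norm presentation: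

* `exists_localLogVolume_eq_int_mul_log` — if `#(O_K/m_K) = p` is PRIME, every compact open additive
  subgroup `G ⊆ K` has `μ^log(G) = k·log p`, `k ∈ ℤ` (balls `m^N ⊆ G ⊆ m^{-M}`; the index
  `[m^{-M} : G]` divides `[m^{-M} : m^N] = p^{N+M}`, Lagrange); with Steinhaus, the same for compact
  additive subgroups of positive volume (`exists_localLogVolume_eq_int_mul_log_of_pos`);
* `exists_localLogVolume_eq_log_nat_add` — every nonempty compact OPEN `A ⊆ K` has `μ^log(A) =
  log m + k·log p` with `m ≥ 1`, `k ∈ ℤ` (the tree's coset decomposition of Prop. 5.7 (i)(c));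
* `eq_prime_pow_of_sum_log_div` — the arithmetic step: positive integers `m_j`, `N_j` with
  `Σ_j (log m_j)/N_j ∈ (Σ_j ℤ/N_j)·log p` are all powers of `p` (unique factorisation in `ℕ`).
Over a residue field of cardinality `p^f`, `f ≥ 2`, the first item fails (subgroups of index `p`
exist) — this is where residue degree one enters (Ξ1^non).  Consumed by `Xi1Model.lean`.
[cite: MochizukiAbsTopIII2015, Prop. 5.7 (i) pp. 137–139] [cite: Mochizuki2012, IUTchIII Rmk. 3.9.5 (iv) p. 128]
Deliberately NOT here: hulls, direct product regions, any judgement on [IUTchIII] Cor. 3.12.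
-/

noncomputable section

open MeasureTheory MeasureTheory.Measure Set Metric TopologicalSpace Bornology Filter
open scoped ENNReal NNReal Pointwise NormedField Topology
open Literature.NumberTheory.GaloisRepresentations.Ultrametric

namespace Literature.IUT.LogVolume

/-! ### One local field: balls inside open sets, bounded sets inside balls -/

section OneField

variable (F : Type*) [NontriviallyNormedField F] [IsUltrametricDist F] [ProperSpace F]

omit [ProperSpace F] in
/-- A neighbourhood of `0` contains a ball `m^N = closedBall 0 ‖ϖ‖^N`.
[cite: MochizukiAbsTopIII2015, Prop. 5.7 (i)(a) p. 137] -/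
theorem exists_closedBall_pow_subset {ϖ : Fˣ} (hϖ : IsUniformizer ϖ) {U : Set F} (hU : IsOpen U)
    (h0 : (0 : F) ∈ U) : ∃ N : ℕ, closedBall (0 : F) (‖(ϖ : F)‖ ^ N) ⊆ U := by
  obtain ⟨ε, hε, hball⟩ := Metric.isOpen_iff.mp hU 0 h0
  obtain ⟨N, hN⟩ := exists_pow_lt_of_lt_one hε hϖ.norm_lt_one
  exact ⟨N, (closedBall_subset_ball hN).trans hball⟩

omit [IsUltrametricDist F] [ProperSpace F] in
/-- A bounded set lies in a ball `m^{-M} = closedBall 0 ‖ϖ‖^{-M}`.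
[cite: MochizukiAbsTopIII2015, Prop. 5.7 (i)(a) p. 137] -/
theorem exists_subset_closedBall_zpow_neg {ϖ : Fˣ} (hϖ : IsUniformizer ϖ) {S : Set F}
    (hS : IsBounded S) : ∃ M : ℕ, S ⊆ closedBall (0 : F) (‖(ϖ : F)‖ ^ (-(M : ℤ))) := by
  obtain ⟨R, hR⟩ := hS.subset_closedBall (0 : F)
  have h1 : 1 < ‖(ϖ : F)‖⁻¹ := (one_lt_inv₀ (norm_units_pos ϖ)).mpr hϖ.norm_lt_one
  obtain ⟨M, hM⟩ := pow_unbounded_of_one_lt R h1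
  refine ⟨M, hR.trans (closedBall_subset_closedBall ?_)⟩
  rw [zpow_neg, zpow_natCast, ← inv_pow]
  exact hM.le

variable [MeasurableSpace F] [BorelSpace F]

/-- The log-volume of the ball of radius `‖u‖` for a unit `u` with `‖u‖ = ‖ϖ‖^n`: `−n·log q`.
[cite: MochizukiAbsTopIII2015, Prop. 5.7 (i)(a) p. 137] -/
theorem localLogVolume_closedBall_norm_of_eq_zpow {ϖ : Fˣ} (hϖ : IsUniformizer ϖ) {u : Fˣ} {n : ℤ}
    (hu : ‖(u : F)‖ = ‖(ϖ : F)‖ ^ n) :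
    localLogVolume F (closedBall (0 : F) ‖(u : F)‖) = -(n * Real.log (residueCard F)) := by
  rw [hu, localLogVolume_closedBall_zpow F hϖ n]

/-- **Volumes of compact open subgroups over a prime residue field.**  If the residue field
`O_K/m_K` has PRIME cardinality `p` (i.e. "the residue field extension degree … is `= 1`"), then every
compact open additive subgroup `G ⊆ K` has log-volume `μ^log(G) = k·log p` for some `k ∈ ℤ`: choosing
balls `m^N ⊆ G ⊆ m^{-M}`, the index `[m^{-M} : G]` divides `[m^{-M} : m^N] = p^{N+M}`, hence is a power
of `p`.  (Over a residue field of cardinality `p^f`, `f ≥ 2`, this fails: subgroups of index `p` exist.)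
[cite: Mochizuki2012, IUTchIII Rmk. 3.9.5 (iv) p. 128] [cite: MochizukiAbsTopIII2015, Prop. 5.7 (i)(a) p. 137] -/
theorem exists_localLogVolume_eq_int_mul_log (hq : (residueCard F).Prime) (G : AddSubgroup F)
    (hGo : IsOpen (G : Set F)) (hGc : IsCompact (G : Set F)) :
    ∃ k : ℤ, localLogVolume F G = k * Real.log (residueCard F) := by
  obtain ⟨ϖ, hϖ⟩ := exists_isUniformizer (F := F)
  obtain ⟨N, hN⟩ := exists_closedBall_pow_subset F hϖ hGo G.zero_mem
  obtain ⟨M, hM⟩ := exists_subset_closedBall_zpow_neg F hϖ hGc.isBounded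
  -- the three open subgroups `B = m^N ≤ G ≤ L = m^{-M}`
  set B : OpenAddSubgroup F := piBall (ϖ ^ N) with hBdef
  set L : OpenAddSubgroup F := piBall (ϖ ^ (-(M : ℤ))) with hLdef
  set Gs : OpenAddSubgroup F := ⟨G, hGo⟩ with hGsdef
  have hBcoe : ((B : OpenAddSubgroup F) : Set F) = closedBall (0 : F) (‖(ϖ : F)‖ ^ N) := by
    rw [hBdef, coe_piBall, Units.val_pow_eq_pow_val, norm_pow]
  have hLcoe : ((L : OpenAddSubgroup F) : Set F) = closedBall (0 : F) (‖(ϖ : F)‖ ^ (-(M : ℤ))) := by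
    rw [hLdef, coe_piBall, Units.val_zpow_eq_zpow_val, norm_zpow]
  have hBG : (B : AddSubgroup F) ≤ G := fun x hx => hN (by rw [← hBcoe]; exact hx)
  have hGL : G ≤ (L : AddSubgroup F) := fun x hx => by
    have := hM hx
    rw [← hLcoe] at this
    exact this
  have hBL : (B : AddSubgroup F) ≤ (L : AddSubgroup F) := hBG.trans hGL
  -- `L` as an integral structure
  let ΛL : IntegralStructure F := ⟨L, by rw [hLcoe]; exact isCompact_closedBall _ _⟩
  have hΛLcoe : (ΛL : Set F) = closedBall (0 : F) (‖(ϖ : F)‖ ^ (-(M : ℤ))) := hLcoe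
  set O : IntegralStructure F := unitBallStructure F with hOdef
  have hq1 : (1 : ℝ) < residueCard F := one_lt_residueCard_real F
  have hlogq : 0 < Real.log (residueCard F) := Real.log_pos hq1
  -- `O`-log-volumes of `B` and `L`
  have hvolB : O.logVolume (B : Set F) = -(N * Real.log (residueCard F)) := by
    rw [hBcoe]
    have := localLogVolume_closedBall_zpow F hϖ (N : ℤ)
    rw [zpow_natCast] at this
    push_cast at this
    exact this
  have hvolL : O.logVolume (ΛL : Set F) = M * Real.log (residueCard F) := by
    rw [hΛLcoe]
    have := localLogVolume_closedBall_zpow F hϖ (-(M : ℤ))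
    push_cast at this
    rw [show localLogVolume F = O.logVolume from rfl] at this
    rw [this]
    ring
  -- positivity / finiteness of the `O`-volumes of `B` and `G`
  have hBpos : 0 < O.haar (B : Set F) := O.haar_pos_of_isOpen B.isOpen ⟨0, B.zero_mem⟩
  have hBfin : O.haar (B : Set F) < ∞ :=
    O.haar_lt_top_of_isCompact (by rw [hBcoe]; exact isCompact_closedBall _ _)
  have hGpos : 0 < O.haar (G : Set F) := O.haar_pos_of_isOpen hGo ⟨0, G.zero_mem⟩
  have hGfin : O.haar (G : Set F) < ∞ := O.haar_lt_top_of_isCompact hGc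
  -- the index `[L : B] = q^(N+M)`
  have hidxB : ((B : AddSubgroup F).relIndex (L : AddSubgroup F) : ℝ) =
      (residueCard F : ℝ) ^ (N + M) := by
    have h1 : ΛL.logVolume (B : Set F) =
        -Real.log ((B : AddSubgroup F).relIndex (L : AddSubgroup F)) :=
      ΛL.logVolume_coe_openAddSubgroup B hBL
    have h2 := O.logVolume_eq_logVolume_sub ΛL hBpos hBfin
    rw [h2, hvolB, hvolL] at h1
    -- `h1 : -(N log q) - M log q = - log [L:B]`
    have hpos : (0 : ℝ) < ((B : AddSubgroup F).relIndex (L : AddSubgroup F) : ℝ) := by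
      exact_mod_cast ΛL.relIndex_pos B
    have hlog : Real.log ((B : AddSubgroup F).relIndex (L : AddSubgroup F) : ℝ) =
        Real.log ((residueCard F : ℝ) ^ (N + M)) := by
      rw [Real.log_pow]; push_cast; linarith
    have hqpow : (0 : ℝ) < (residueCard F : ℝ) ^ (N + M) := pow_pos (by linarith) _
    exact Real.log_injOn_pos (Set.mem_Ioi.mpr hpos) (Set.mem_Ioi.mpr hqpow) hlog
  have hidxB' : (B : AddSubgroup F).relIndex (L : AddSubgroup F) = residueCard F ^ (N + M) := by
    exact_mod_cast hidxB
  -- `[L : G]` divides it, hence is a power of `q`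
  have hdvd : (G.relIndex (L : AddSubgroup F)) ∣ residueCard F ^ (N + M) := by
    rw [← hidxB']
    exact AddSubgroup.relIndex_dvd_of_le_left (L : AddSubgroup F) hBG
  obtain ⟨a, -, ha⟩ := (Nat.dvd_prime_pow hq).mp hdvd
  -- `O`-log-volume of `G`
  have h3 : ΛL.logVolume (G : Set F) = -Real.log (G.relIndex (L : AddSubgroup F)) :=
    ΛL.logVolume_coe_openAddSubgroup Gs hGL
  have h4 := O.logVolume_eq_logVolume_sub ΛL hGpos hGfin
  rw [h4, hvolL, ha] at h3
  push_cast at h3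
  rw [Real.log_pow] at h3
  refine ⟨(M : ℤ) - a, ?_⟩
  rw [show localLogVolume F (G : Set F) = O.logVolume (G : Set F) from rfl]
  push_cast
  linarith

/-- A compact additive subgroup of positive volume is open (Steinhaus: `G − G = G` is a neighbourhood
of `0`). [cite: MochizukiAbsTopIII2015, Prop. 5.7 (i)(a) p. 137] -/
theorem isOpen_of_isCompact_of_localVolume_pos (G : AddSubgroup F) (hGc : IsCompact (G : Set F))
    (hGpos : 0 < localVolume F G) : IsOpen (G : Set F) := by
  haveI : (localVolume F).Regular := by unfold localVolume; infer_instance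
  have hmem : (G : Set F) - (G : Set F) ∈ 𝓝 (0 : F) :=
    sub_mem_nhds_zero_of_addHaar_pos_ne_top (localVolume F) (G : Set F) hGc.isClosed.measurableSet
      hGpos (hGc.measure_lt_top).ne
  have hsub : (G : Set F) - (G : Set F) ⊆ G := by
    rintro _ ⟨x, hx, y, hy, rfl⟩
    exact G.sub_mem hx hy
  exact G.isOpen_of_mem_nhds (Filter.mem_of_superset hmem hsub)

/-- Combining the two: over a prime residue field, a compact additive subgroup of positive volume has
log-volume in `ℤ·log p`. [cite: Mochizuki2012, IUTchIII Rmk. 3.9.5 (iv) p. 128] -/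
theorem exists_localLogVolume_eq_int_mul_log_of_pos (hq : (residueCard F).Prime) (G : AddSubgroup F)
    (hGc : IsCompact (G : Set F)) (hGpos : 0 < localVolume F G) :
    ∃ k : ℤ, localLogVolume F G = k * Real.log (residueCard F) :=
  exists_localLogVolume_eq_int_mul_log F hq G (isOpen_of_isCompact_of_localVolume_pos F G hGc hGpos) hGc

/-- **Volumes of compact open subsets over a prime residue field.**  If `#(O_K/m_K) = p` is prime,
every nonempty compact open `A ⊆ K` has `μ^log(A) = log m + k·log p` with `m ≥ 1` an integer and
`k ∈ ℤ`: `A` is a disjoint union of `m` cosets of a small compact open subgroup `H ≤ O_K` (the tree's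
coset decomposition of [AbsTopIII] Prop. 5.7 (i)), and `μ^log(H) ∈ ℤ·log p`.
[cite: MochizukiAbsTopIII2015, Prop. 5.7 (i)(a)(c) pp. 137–139] -/
theorem exists_localLogVolume_eq_log_nat_add (hq : (residueCard F).Prime) {A : Set F}
    (hAc : IsCompact A) (hAo : IsOpen A) (hne : A.Nonempty) :
    ∃ (m : ℕ) (k : ℤ), 0 < m ∧
      localLogVolume F A = Real.log m + k * Real.log (residueCard F) := by
  classical
  set O : IntegralStructure F := unitBallStructure F with hOdef
  let Ac : CompactOpens F := ⟨⟨A, hAc⟩, hAo⟩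
  have hAcoe : (Ac : Set F) = A := rfl
  obtain ⟨H, hHO, hHA⟩ := O.exists_openAddSubgroup_cosets_subset Ac
  obtain ⟨C, rep, hrep, hAeq⟩ := IntegralStructure.exists_finset_eq_biUnion_coset Ac H hHA
  have hmeas := O.haar_biUnion_coset H C rep fun c hc => (hrep c hc).2
  rw [← hAeq, hAcoe] at hmeas
  -- `H` is a compact open subgroup, so `μ^log(H) = k log p`
  have hHsub : ((H : AddSubgroup F) : Set F) ⊆ (O : Set F) := fun x hx => hHO hx
  have hHc : IsCompact ((H : AddSubgroup F) : Set F) := O.isCompact.of_isClosed_subset H.isClosed hHsub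
  obtain ⟨k, hk⟩ := exists_localLogVolume_eq_int_mul_log F hq (H : AddSubgroup F) H.isOpen hHc
  -- `C` is nonempty
  have hCpos : 0 < C.card := by
    rw [Finset.card_pos]
    obtain ⟨x, hx⟩ := hne
    rw [← hAcoe, hAeq] at hx
    obtain ⟨c, hc, -⟩ := Set.mem_iUnion₂.mp hx
    exact ⟨c, hc⟩
  have hHpos : 0 < (O.haar (H : Set F)).toReal :=
    ENNReal.toReal_pos (O.haar_pos_of_isOpen H.isOpen ⟨0, H.zero_mem⟩).ne'
      (O.haar_lt_top_of_isCompact hHc).ne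
  refine ⟨C.card, k, hCpos, ?_⟩
  rw [show localLogVolume F A = Real.log (O.haar A).toReal from rfl, hmeas, ENNReal.toReal_mul,
    ENNReal.toReal_natCast, Real.log_mul (by exact_mod_cast hCpos.ne') hHpos.ne', ← hk]
  rfl

end OneField

/-! ### An arithmetic lemma: unique factorisation forces `p`-power multiplicities -/

section Arithmetic

/-- If positive integers `m_j` and `N_j` satisfy `Σ_j (log m_j)/N_j = (Σ_j z_j/N_j)·log p` for a prime
`p` and integers `z_j`, then every `m_j` is a power of `p`: clearing denominators with `L = ∏ N_j`,
`∏_j m_j^{L/N_j} = p^Z`, and unique factorisation in `ℕ` applies. (The step of (Ξ1^non) where the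
RATIONALITY of the printed normalized weights `1/N_v` of [IUTchIII] Rmk. 3.1.1 (ii) is used.)
[cite: Mochizuki2012, IUTchIII Rmk. 3.1.1 (ii) p. 94] -/
theorem eq_prime_pow_of_sum_log_div {J : Type*} [Fintype J] {p : ℕ} (hp : p.Prime) (N : J → ℕ)
    (hN : ∀ j, 0 < N j) (m : J → ℕ) (hm : ∀ j, 0 < m j) (z : J → ℤ)
    (h : ∑ j, Real.log (m j) / N j = (∑ j, (z j : ℝ) / N j) * Real.log p) :
    ∀ j, ∃ b : ℕ, m j = p ^ b := by
  classical
  -- complementary products `e_j = ∏_{i ≠ j} N_i`, so that `N_j · e_j = L := ∏_i N_i`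
  set L : ℕ := ∏ i, N i with hLdef
  set e : J → ℕ := fun j => ∏ i ∈ Finset.univ.erase j, N i with hedef
  have hLpos : 0 < L := Finset.prod_pos fun i _ => hN i
  have he : ∀ j, N j * e j = L := fun j => Finset.mul_prod_erase Finset.univ N (Finset.mem_univ j)
  have hepos : ∀ j, 0 < e j := fun j => Finset.prod_pos fun i _ => hN i
  have hLdiv : ∀ j, (L : ℝ) / N j = e j := fun j => by
    have hNj : (N j : ℝ) ≠ 0 := by exact_mod_cast (hN j).ne'
    rw [div_eq_iff hNj, ← he j]
    push_cast
    ring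
  -- clear denominators
  have hl : ∀ j, (L : ℝ) * (Real.log (m j) / N j) = e j * Real.log (m j) := fun j => by
    have hNj : (N j : ℝ) ≠ 0 := by exact_mod_cast (hN j).ne'
    rw [← he j]
    push_cast
    field_simp
  have hr : ∀ j, (L : ℝ) * ((z j : ℝ) / N j) = e j * z j := fun j => by
    have hNj : (N j : ℝ) ≠ 0 := by exact_mod_cast (hN j).ne'
    rw [← he j]
    push_cast
    field_simp
  have h1 : ∑ j, (e j : ℝ) * Real.log (m j) = (∑ j, (e j : ℝ) * z j) * Real.log p :=
    calc ∑ j, (e j : ℝ) * Real.log (m j) = ∑ j, (L : ℝ) * (Real.log (m j) / N j) :=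
          Finset.sum_congr rfl fun j _ => (hl j).symm
      _ = (L : ℝ) * ∑ j, Real.log (m j) / N j := by rw [Finset.mul_sum]
      _ = (L : ℝ) * ((∑ j, (z j : ℝ) / N j) * Real.log p) := by rw [h]
      _ = (∑ j, (L : ℝ) * ((z j : ℝ) / N j)) * Real.log p := by rw [← mul_assoc, Finset.mul_sum]
      _ = (∑ j, (e j : ℝ) * z j) * Real.log p := by rw [Finset.sum_congr rfl fun j _ => hr j]
  -- the integer `Z = Σ e_j z_j` is nonnegative
  set Z : ℤ := ∑ j, (e j : ℤ) * z j with hZdef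
  have hZcast : (∑ j, (e j : ℝ) * z j) = (Z : ℝ) := by rw [hZdef]; push_cast; rfl
  have hlogp : 0 < Real.log p := Real.log_pos (by exact_mod_cast hp.one_lt)
  have hlhs : 0 ≤ ∑ j, (e j : ℝ) * Real.log (m j) := Finset.sum_nonneg fun j _ =>
    mul_nonneg (Nat.cast_nonneg _) (Real.log_nonneg (by exact_mod_cast hm j))
  have hZnn : 0 ≤ Z := by
    have : (0 : ℝ) ≤ (Z : ℝ) * Real.log p := by rw [← hZcast, ← h1]; exact hlhs
    exact_mod_cast nonneg_of_mul_nonneg_left this hlogp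
  obtain ⟨Zn, hZn⟩ := Int.eq_ofNat_of_zero_le hZnn
  -- `∏ m_j^{e_j} = p^Zn` in `ℕ`
  have hprod : (∏ j, m j ^ e j : ℕ) = p ^ Zn := by
    have hlog : Real.log ((∏ j, m j ^ e j : ℕ) : ℝ) = Real.log ((p ^ Zn : ℕ) : ℝ) := by
      push_cast
      rw [Real.log_prod (fun j _ => pow_ne_zero _ (by exact_mod_cast (hm j).ne')), Real.log_pow,
        Finset.sum_congr rfl fun j _ => Real.log_pow (m j : ℝ) (e j), h1, hZcast, hZn]
      push_cast
      ring
    have h0 : (0 : ℝ) < ((∏ j, m j ^ e j : ℕ) : ℝ) := by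
      exact_mod_cast Finset.prod_pos fun j _ => pow_pos (hm j) _
    have h0' : (0 : ℝ) < ((p ^ Zn : ℕ) : ℝ) := by exact_mod_cast pow_pos hp.pos _
    exact_mod_cast Real.log_injOn_pos (Set.mem_Ioi.mpr h0) (Set.mem_Ioi.mpr h0') hlog
  intro j
  have hdvd : m j ∣ p ^ Zn := by
    rw [← hprod]
    exact (dvd_pow_self (m j) (hepos j).ne').trans (Finset.dvd_prod_of_mem _ (Finset.mem_univ j))
  obtain ⟨b, -, hb⟩ := (Nat.dvd_prime_pow hp).mp hdvd
  exact ⟨b, hb⟩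

end Arithmetic

end Literature.IUT.LogVolume

end
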